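import Summits.CriticalPhenomena.PercolationContinuityZ3.Theorems.PercNearOneGluingNoHeavyPcintBFibZ4
import Summits.CriticalPhenomena.PercolationContinuityZ3.Theorems.PercNearOneGluingNoHeavyPcintBFibZ9
import HarnessLib

/-!
# PCINT lane — STRUCTURE conjecture **C-B1** (mean-field law of the bond T-fibre comparison, complete bipartite fibres), TYPED

HONEST FRAMING: a statement about the lane's own comparison inequalities (the Reed–Frost chain-binomial size law `BFib.lawA`
of `…PcintBFibLevelsLaw.lean` inside the criterion `BFib.criticalProb_lfib_le_of_table`), found numerically, pre-registered
three times and scored HIT each time; NOT a theorem and NOT used by any certified cell (the cells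
`BFib.criticalProb_Z{d}_le_{P}` check the whole table by kernel computation, `BFib.checkBond`).  Coordinator
STANDING RULE 2026-08-22 «NUMERICS ⇒ STRUCTURE ⇒ CONJECTURE», item (5): a conjecture surviving three pre-registered
predictions is typed as a Lean `Prop` with its evidence ledger (same placement as `…PcintUFibDenseTypeLaw.lean`).
Statement of record: run/shared/lean/prim/pcint/STRUCTURE.md (C-B1, P-B1..P-B3).

THE OBJECTS.  Bond T-fibre comparison (PHASE 3): `𝕋`-bond at the lane level `s = 3473/10⁴`
(`> 2 sin(π/18) ≥ p_c^bond(𝕋)`) against `(𝕋 × K_{n,n})`-bond at density `p`; the usable set of an entered site is the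
breadth-first ball of depth `D` grown in its fibre from ONE entry cell, whose size has the chain-binomial law
`u ↦ lawA p D 0 1 (n-1) n u` (`BFib.sum_wt_card_growB`).  For `k ≤ 5` children and a level `1 ≤ j ≤ k` the tail
inequality of `BFib.dominating` reads `tailIneq n D k j p : (Σ_u law u) · T_j(k, s) ≤ Σ_u law u · T_j(k, 1 − (1−p)^u)`
(`T = UFib.binTail`); `tableHolds n D p` = all fifteen; `pstar n` = `inf {p ∈ [0,1] : tableHolds n (2n) p}` (depth `2n`
exceeds the diameter of `K_{n,n}`: the full cluster).

THE LAW (C-B1).  (a) `singleBinding`: the `(k,j) = (5,1)` inequality ("none of five children entered") implies the whole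
table, for every `n`, `D`, `p`.  (b) `meanFieldSaturation`: `n ↦ n · pstar n` is strictly increasing with non-increasing
increments and converges to the MEAN-FIELD CONSTANT `c⋆ ≈ 2.4198`: at `p = c/n` the one-cell cluster of `K_{n,n}` is the
Poisson(`c`) Galton–Watson tree, finite clusters contribute nothing to the right-hand side in the limit, the giant component
has density `σ = 1 − e^{−cσ}` and `(1−p)^u → e^{−2cσ}` on it, so the binding inequality becomes
`σ (1 − e^{−10 c σ}) ≥ 1 − (1 − s)^5`, with equality at `c = c⋆` (`σ⋆ = 0.8815410…`, `c⋆ = −log(1 − σ⋆)/σ⋆ = 2.41984…`).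
MECHANISM: with a single entry cell the TYPE of the examiner drops out (`BFib.sum_pw_step_pattern`), so the comparison is a
statement about ONE integer law; the all-fail event `j = 1, k = 5` is the extreme down-set of the children law, and the
`1/n` scaling is the mean-field window of `K_{n,n}`.

EVIDENCE LEDGER (prim-pcint-1 gen 13; scripts prim-pcint-1/gen13/num/knnbfs.py (level recursion), knn_dp.py (dynamic
programme over (remaining A, remaining B, level size, side)), exactcheck.py (exact rationals = `BFib.checkBond`);
thresholds = bisection on the minimum slack over all `(k, j)`, level `s = 2 sin(π/18) + 10⁻⁴`, full depth unless stated):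
`pstar` ≈ 0.274643 (n=2) 0.247942 0.225764 0.207100 0.191204 0.177518 0.165621 0.155192 0.145977 0.137781 0.130444
0.123841 0.117868 0.112439 0.107484 (n=16); depth 6: 0.098825 (18) 0.091421 (20) 0.079503 (24) 0.070334 (28) 0.063063 (32);
binding ALWAYS `(5,1)`; `n · pstar n` = 0.549 0.744 0.903 1.036 1.147 1.243 1.325 1.397 1.460 1.516 1.565 1.610 1.650
1.687 1.720 (n=16), 1.779 1.828 1.908 1.969 2.018 (n = 18, 20, 24, 28, 32; depth 6) — increasing, increments decreasing,
below `c⋆`.  PRE-REGISTERED (files sealed by sha256 in the session NOTES.md BEFORE the runs, copies in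
run/shared/lean/prim/pcint/predictions/ and attached as evidence on stmt-CriticalPhenomena-4575): P-B1 (10612ca5…):
K_{14,14} (D=6) ∈ [0.1160, 0.1200] → 0.117900 HIT, K_{16,16} ∈ [0.1050, 0.1095] → 0.107528 HIT, binding (5,1) ×2 HIT;
P-B2 (108fd832…): K_{18,18} ∈ [0.0973, 0.1003] → 0.098825 HIT, K_{20,20} ∈ [0.0898, 0.0929] → 0.091421 HIT, log-slopes in
[−0.80, −0.69] and steepening → −0.717, −0.739 HIT, `n·p*` increasing HIT; P-B3 (331dedc2…): K_{24,24}, K_{28,28}, K_{32,32}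
bands → 0.079503, 0.070334, 0.063063 HIT ×3, binding (5,1) ×3 HIT, slopes −0.766/−0.795/−0.817 HIT, `n·p*`
1.908 < 1.969 < 2.018 HIT.
KERNEL SANITY (proved below, no `sorry`): the table holds at the landed cells — `tableHolds 2 4 0.2746` (`BFib.checkBond_4`,
full depth) hence `pstar 2 ≤ 0.2746` (numerically `0.274643`), and `tableHolds 12 3 0.1323` (`BFib.checkBond_9`, depth 3).

Change log: 2026-08-23 prim-pcint-1 gen 13 (prover-prim-pcint-1-g13-0): v1.
-/

noncomputable section

namespace Summit.CriticalPhenomena.PercolationContinuityZ3.Theorems.Pcint.BFib.MeanField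

open Finset Filter Topology AdaptDom Summit.CriticalPhenomena.PercolationContinuityZ3.Theorems.Pcint.UFib
  Summit.CriticalPhenomena.PercolationContinuityZ3.Theorems.Pcint.BFib

/-- The comparison level `s = 0.3473` of the lane's bond T-fibre cells (`> 2 sin(π/18)`,
`BFib.two_mul_sin_pi_div_eighteen_lt`). -/
def sLane : ℝ := 3473 / 10000

/-- **One tail inequality** of the bond comparison for the fibre `K_{n,n}`, growth depth `D`, `k` children, level `j`,
density `p` (law `BFib.lawA p D 0 1 (n-1) n`, tails `UFib.binTail`). -/
def tailIneq (n D k j : ℕ) (p : ℝ) : Prop :=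
  (∑ u ∈ range (2 * n + 1), lawA p D 0 1 (n - 1) n u) * binTail k sLane j ≤
    ∑ u ∈ range (2 * n + 1), lawA p D 0 1 (n - 1) n u * binTail k (1 - (1 - p) ^ u) j

/-- **The whole tail table** (`k ≤ 5`, `1 ≤ j ≤ k`) of `K_{n,n}` at depth `D` and density `p`. -/
def tableHolds (n D : ℕ) (p : ℝ) : Prop :=
  ∀ k j : ℕ, k ≤ 5 → 1 ≤ j → j ≤ k → tailIneq n D k j p

/-- **The bond comparison threshold of `K_{n,n}`**: the least density at which the full-depth table holds. -/
def pstar (n : ℕ) : ℝ := sInf {p : ℝ | 0 ≤ p ∧ p ≤ 1 ∧ tableHolds n (2 * n) p}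

/-- **The mean-field equations** of the limit constant: giant density `σ = 1 − e^{−cσ}` and the binding inequality with
equality, `σ (1 − e^{−10cσ}) = 1 − (1 − s)^5` (numerically `σ = 0.8815410…`, `c = 2.41984…`). -/
def IsMeanFieldConstant (c : ℝ) : Prop :=
  ∃ σ : ℝ, 0 < σ ∧ σ < 1 ∧ σ = 1 - Real.exp (-(c * σ)) ∧ σ * (1 - Real.exp (-(10 * c * σ))) = 1 - (1 - sLane) ^ 5

/-- **C-B1 (a), single binding inequality** (STRUCTURE.md C-B1; P-B1/P-B2/P-B3, HIT ×3): for every fibre size `n ≥ 1`, depth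
`D` and density `p ∈ (0,1)`, the `(k,j) = (5,1)` inequality implies the whole tail table. -/
@[conjecture] def singleBinding : Prop :=
  ∀ n D : ℕ, 1 ≤ n → ∀ p : ℝ, 0 < p → p < 1 → tailIneq n D 5 1 p → tableHolds n D p

/-- **C-B1 (b), mean-field saturation** (STRUCTURE.md C-B1; P-B1 (d), P-B2 (d,e), P-B3, HIT): `n · pstar n` is strictly
increasing in `n ≥ 2` with non-increasing increments, and converges to a mean-field constant (`≈ 2.4198`). -/
@[conjecture] def meanFieldSaturation : Prop :=
  (∀ n : ℕ, 2 ≤ n → (n : ℝ) * pstar n < (n + 1 : ℕ) * pstar (n + 1)) ∧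
  (∀ n : ℕ, 2 ≤ n →
    ((n + 2 : ℕ) : ℝ) * pstar (n + 2) - (n + 1 : ℕ) * pstar (n + 1) ≤ (n + 1 : ℕ) * pstar (n + 1) - n * pstar n) ∧
  ∃ c : ℝ, IsMeanFieldConstant c ∧ Tendsto (fun n : ℕ => (n : ℝ) * pstar n) atTop (𝓝 c)

/-! ### Kernel sanity: the table holds at the landed cells -/

/-- The table of `BFib.dominating` from a passed `BFib.checkBond`, in the language of this file. -/
theorem tableHolds_of_checkBond {n D P : ℕ} (hn : 1 ≤ n) (h : checkBond n D ((P : ℚ) / 10000) (3473 / 10000) = true) :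
    tableHolds n D ((P : ℝ) / 10000) := by
  intro k j hk hj1 hjk
  have t := (table_of_checkBond h hn).2 k hk j hj1 hjk
  have hp : ((((P : ℚ) / 10000 : ℚ) : ℝ)) = (P : ℝ) / 10000 := by push_cast; ring
  have hs : ((((3473 : ℚ) / 10000 : ℚ) : ℝ)) = sLane := by unfold sLane; push_cast; ring
  rw [hp, hs] at t
  exact t

/-- **The full-depth table of `K_{2,2}` holds at `p = 0.2746`** (the landed `ℤ⁴` cell; kernel computation
`BFib.checkBond_4`, depth `4 = 2·2`). -/
theorem tableHolds_two : tableHolds 2 4 ((2746 : ℝ) / 10000) :=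
  tableHolds_of_checkBond (n := 2) (P := 2746) (by norm_num) (by exact_mod_cast checkBond_4)

/-- **The depth-3 table of `K_{12,12}` holds at `p = 0.1323`** (the landed `ℤ⁹` cell; kernel computation `BFib.checkBond_9`). -/
theorem tableHolds_twelve : tableHolds 12 3 ((1323 : ℝ) / 10000) :=
  tableHolds_of_checkBond (n := 12) (P := 1323) (by norm_num) (by exact_mod_cast checkBond_9)

/-- The threshold is at most any density in `[0,1]` at which the full-depth table holds. -/
theorem pstar_le {n : ℕ} {p : ℝ} (hp0 : 0 ≤ p) (hp1 : p ≤ 1) (h : tableHolds n (2 * n) p) : pstar n ≤ p :=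
  csInf_le ⟨0, fun _ hq => hq.1⟩ ⟨hp0, hp1, h⟩

/-- **`pstar 2 ≤ 0.2746`** (numerically `pstar 2 = 0.274643…`). -/
theorem pstar_two_le : pstar 2 ≤ (2746 : ℝ) / 10000 :=
  pstar_le (by norm_num) (by norm_num) tableHolds_two

end Summit.CriticalPhenomena.PercolationContinuityZ3.Theorems.Pcint.BFib.MeanField

end
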